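import Literature.NumberTheory.Automorphic.LieCentralizerTorus
import Literature.NumberTheory.Automorphic.RootSpaceDimension
import Literature.NumberTheory.Automorphic.CentralizerLieAlgebra
import Literature.NumberTheory.Automorphic.CentralizerTorusConnected
import HarnessLib

/-!
# Discharge of the named fact `lieWeightSpace_one_le_lieAlgebraGL` (`𝔤^T ⊆ L(T)`), every
# characteristic
(trunk T-AUTOMORPHIC, G25 AutomorphicL)

`RootSpaceDimension.lean` isolates Springer 5.4.7 with 7.6.4 (ii) — `𝔤^T ⊆ L(T)` for a maximal
torus `T` of a connected reductive `G ≤ GL_n` over an algebraically closed field — as the named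
fact (closed `Prop`) `lieWeightSpace_one_le_lieAlgebraGL G T`, an input of
`zdim_eq_rank_add_card_roots_of_lie` and `chevalley_isomorphism_of_structureFacts₃` there, of
`torus_sup_rootSubgroups_eq_of_lieWeights_subset` (`IsomorphismTheoremUniqueLie.lean`) and of
`torus_sup_rootSubgroups_eq_of_facts` (`TorusRootSubgroupsGenerate.lean`). This file records its
discharge **`lieWeightSpace_one_le_lieAlgebraGL_holds`**, now over algebraically closed fields of
**every** characteristic, exactly as printed: Springer 5.4.7, *"`L(Z_G(D)) = 𝔷_𝔤(D)`"* for the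
subtorus `D = T` acting by inner automorphisms — the inclusion `𝔤^T ⊆ L(Z_G(T))` is
`IsTorusSubgroup.lieWeightSpace_one_le_lieAlgebraGL_centralizer` (`CentralizerLieAlgebra.lean`,
Springer's induction on `dim G` through 5.4.4 (ii), all characteristics) — combined with 7.6.4 (ii),
*"`Z_G(T) = T`"* (`centralizer_eq_of_isMaximalTorusIn_holds`, `CentralizerTorusConnected.lean`),
assembled by `lieWeightSpace_one_le_lieAlgebraGL_of_centralizer` (`RootSpaceDimension.lean`).
(The first version of this file proved the statement in characteristic `0` only, through
`lieWeightSpace_one_le_lieAlgebraGL_of_charZero` of `LieCentralizerTorus.lean` — Jordan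
decomposition, the algebraic hull, Engel and Cartan's criterion; that theorem is untouched and the
import is kept for the files downstream.) The statement of the named fact is unchanged; the
discharge keeps its name and is now the closed statement `∀ G T, lieWeightSpace_one_le_lieAlgebraGL G T`
(the fact takes `G, T` as explicit parameters), so every user
(`lieWeightSpace_one_le_lieAlgebraGL_holds G T`) elaborates as before, the `CharZero` instance
simply no longer being looked for.

## References

* T. A. Springer, *Linear Algebraic Groups*, 2nd ed., Progress in Mathematics 9, Birkhäuser
  (1998), Cor. 5.4.7 (p. 90), Cor. 7.6.4 (ii) (p. 134) [SpringerLAG1998].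
-/

noncomputable section

open scoped MatrixGroups

namespace Literature.NumberTheory.Automorphic

variable {k : Type*} [Field k] {n : Type*} [Fintype n] [DecidableEq n]

/-- **`lieWeightSpace_one_le_lieAlgebraGL` holds (every characteristic)**: `𝔤^T ⊆ L(T)` for a
maximal torus `T` of a connected reductive `G ≤ GL_n` over an algebraically closed field. Springer
5.4.7 for `D = T` (`𝔤^T = 𝔷_𝔤(T) ⊆ L(Z_G(T))`,
`IsTorusSubgroup.lieWeightSpace_one_le_lieAlgebraGL_centralizer`) and 7.6.4 (ii) (`Z_G(T) = T`,
`centralizer_eq_of_isMaximalTorusIn_holds`), put together by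
`lieWeightSpace_one_le_lieAlgebraGL_of_centralizer`. [cite: SpringerLAG1998, Cor. 5.4.7 and Cor. 7.6.4 (ii)] -/
theorem lieWeightSpace_one_le_lieAlgebraGL_holds :
    ∀ G T : Subgroup (GL n k), lieWeightSpace_one_le_lieAlgebraGL G T :=
  fun _ _ => lieWeightSpace_one_le_lieAlgebraGL_of_centralizer
    (fun hG hT => hT.2.1.lieWeightSpace_one_le_lieAlgebraGL_centralizer hG.1 hT.1)
    centralizer_eq_of_isMaximalTorusIn_holds

-- The characteristic-`0` route is still available: in characteristic `0` the discharge agrees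
-- with `lieWeightSpace_one_le_lieAlgebraGL_of_charZero` (`LieCentralizerTorus.lean`, Cartan's
-- criterion), both proving the same proposition (Springer 5.4.7 with 7.6.4 (ii)).
example [CharZero k] (G T : Subgroup (GL n k)) : lieWeightSpace_one_le_lieAlgebraGL G T :=
  fun hG hT => lieWeightSpace_one_le_lieAlgebraGL_of_charZero hG hT

end Literature.NumberTheory.Automorphic
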